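import Literature.Geometry.Manifold.ShuffleFubini
import Literature.Geometry.Manifold.ShuffleSimplexCube
import Literature.Geometry.Manifold.DeRhamMap
import Literature.Geometry.Kaehler.WedgeBlockProduct
import Literature.Geometry.Kaehler.ManifoldFormsPullback
import Literature.NumberTheory.Transcendental.FormsAlgebraWedgeAssocProofs
import Literature.NumberTheory.Transcendental.FormsAlgebraWedgeCommProofs
import HarnessLib

/-!
# The integral of a cross product of forms over the shuffle product of two smooth simplices

Topic `Literature/Geometry/Manifold`. For smooth singular simplices `σ : Δᵏ → M`, `τ : Δˡ → N`
and smooth forms `α ∈ Ωᵏ(M)`, `β ∈ Ωˡ(N)`, the **cross product form**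
`α ⊠ β = pr₁^*α ∧ pr₂^*β ∈ Ω^{k+l}(M × N)` (`crossForm`) integrates over the Eilenberg–Zilber
shuffle product `σ × τ = Σ_w ± (σ,τ)_w` (`…SingularHomology.EilenbergZilber.ezMap`) to the product of
the integrals (`integrationFunctional_crossForm_ezMap`):

`∫_{σ × τ} α ⊠ β = (∫_σ α) · (∫_τ β)`,

and to `0` over the shuffle product of a `p`-simplex and a `q`-simplex with `p + q = k + l`,
`p ≠ k` (`integrationFunctional_crossForm_ezMap_eq_zero`). In the collapsed-cube coordinates of
the tree's simplex integral (`…SingularSimplex.formIntegral`), the cube parametrisation of a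
shuffle simplex is `(σ.cubeMap ∘ S_w, τ.cubeMap ∘ T_w)` (`…ShuffleSimplexCube.cubeMap_tupleSimplex`),
so its integrand is the shuffle integrand of the within-cube pull-back
`Ω = (α ⊠ β)^*_{[0,1]ᵏ×[0,1]ˡ}` along the product of the cube maps
(`formIntegrand_tupleSimplex`); the shuffle Fubini identity (`…ShuffleFubini.shuffle_sum_setIntegral_eq`)
turns the signed sum into `∫_{[0,1]ᵏ×[0,1]ˡ} Ω(x)(block frame) dx`, the block frame is mapped by
the derivative of the product map to a block family on which `α ⊠ β` is the product
`(σ^*α)(e) · (τ^*β)(e')` (`…WedgeBlockProduct.wedge_fst_snd_apply_blockVec`), and Fubini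
(`MeasureTheory.setIntegral_prod_mul`) finishes. This is the analytic input of the
multiplicativity of de Rham's integration map (Bredon (1993), VI §4; de Rham 1931).

Everything is proved; no named facts.

## References

* G. E. Bredon, *Topology and Geometry*, GTM 139 (1993), VI §4. [Bredon1993]
* J. M. Lee, *Introduction to Smooth Manifolds*, 2nd ed. (2013), Prop. 18.9, p. 481. [LeeSmoothManifolds2013]
-/

noncomputable section

-- `TangentSpace 𝓘(ℝ, ℝᵏ) t = ℝᵏ`, `TangentSpace (I.prod I') z = E × E'` are used up to unfolding
set_option backward.isDefEq.respectTransparency false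

open scoped Manifold ContDiff Topology
open Set Filter MeasureTheory Function Literature.LinearAlgebra.Alternating Literature.Geometry.Kaehler
open Literature.AlgebraicTopology.SingularHomology Literature.AlgebraicTopology.SingularHomology.ShuffleChains
  Literature.AlgebraicTopology.SingularHomology.EilenbergZilber Literature.NumberTheory.Transcendental

universe u

namespace Literature.Geometry.Manifold

variable {E : Type u} [NormedAddCommGroup E] [NormedSpace ℝ E] {H : Type u} [TopologicalSpace H]
  {I : ModelWithCorners ℝ E H} {M : Type u} [TopologicalSpace M] [ChartedSpace H M]
  {E' : Type u} [NormedAddCommGroup E'] [NormedSpace ℝ E'] {H' : Type u} [TopologicalSpace H']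
  {I' : ModelWithCorners ℝ E' H'} {N : Type u} [TopologicalSpace N] [ChartedSpace H' N]
  {F : Type*} [NormedAddCommGroup F] [NormedSpace ℝ F] {k l p q n : ℕ}

/-! ### The product of the cube parametrisations -/

/-- The product of the cube parametrisations of two simplices: `(x, x') ↦ (σ.cubeMap x, τ.cubeMap x')`. [folklore] -/
def prodCubeMap (σ : SingularSimplex M p) (τ : SingularSimplex N q) (x : X p q) : M × N := (σ.cubeMap x.1, τ.cubeMap x.2)

/-- Values of the product parametrisation. [folklore] -/
theorem prodCubeMap_apply (σ : SingularSimplex M p) (τ : SingularSimplex N q) (x : X p q) :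
    prodCubeMap σ τ x = (σ.cubeMap x.1, τ.cubeMap x.2) := rfl

/-- The product of cubes has unique derivatives. [folklore] -/
theorem uniqueDiffOn_prodCube (p q : ℕ) : UniqueDiffOn ℝ (unitCube p ×ˢ unitCube q : Set (X p q)) :=
  (uniqueDiffOn_unitCube p).prod (uniqueDiffOn_unitCube q)

/-- **The product parametrisation of smooth simplices is `C^∞` within the product of cubes.** [cite: LeeSmoothManifolds2013, p. 481] -/
theorem contMDiffOn_prodCubeMap {σ : SingularSimplex M p} {τ : SingularSimplex N q} (hσ : σ.IsSmooth I) (hτ : τ.IsSmooth I') :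
    ContMDiffOn 𝓘(ℝ, X p q) (I.prod I') ∞ (prodCubeMap σ τ) (unitCube p ×ˢ unitCube q) :=
  (hσ.contMDiffOn_cubeMap.comp (ContinuousLinearMap.fst ℝ (Fin p → ℝ) (Fin q → ℝ)).contMDiff.contMDiffOn
      (fun _ hx ↦ hx.1)).prodMk
    (hτ.contMDiffOn_cubeMap.comp (ContinuousLinearMap.snd ℝ (Fin p → ℝ) (Fin q → ℝ)).contMDiff.contMDiffOn
      (fun _ hx ↦ hx.2))

/-- The derivative of the product parametrisation within the product of cubes is the product of the
derivatives. [cite: LeeSmoothManifolds2013, p. 481] -/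
theorem hasMFDerivWithinAt_prodCubeMap {σ : SingularSimplex M p} {τ : SingularSimplex N q} (hσ : σ.IsSmooth I)
    (hτ : τ.IsSmooth I') {x : X p q} (hx : x ∈ (unitCube p ×ˢ unitCube q : Set (X p q))) :
    HasMFDerivWithinAt 𝓘(ℝ, X p q) (I.prod I') (prodCubeMap σ τ) (unitCube p ×ˢ unitCube q) x
      (((mfderivWithin 𝓘(ℝ, Fin p → ℝ) I σ.cubeMap (unitCube p) x.1).comp (ContinuousLinearMap.fst ℝ (Fin p → ℝ) (Fin q → ℝ))).prod
        ((mfderivWithin 𝓘(ℝ, Fin q → ℝ) I' τ.cubeMap (unitCube q) x.2).comp (ContinuousLinearMap.snd ℝ (Fin p → ℝ) (Fin q → ℝ)))) := by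
  have h1 : HasMFDerivWithinAt 𝓘(ℝ, Fin p → ℝ) I σ.cubeMap (unitCube p) x.1
      (mfderivWithin 𝓘(ℝ, Fin p → ℝ) I σ.cubeMap (unitCube p) x.1) :=
    ((hσ.contMDiffOn_cubeMap x.1 hx.1).mdifferentiableWithinAt (by simp)).hasMFDerivWithinAt
  have h2 : HasMFDerivWithinAt 𝓘(ℝ, Fin q → ℝ) I' τ.cubeMap (unitCube q) x.2
      (mfderivWithin 𝓘(ℝ, Fin q → ℝ) I' τ.cubeMap (unitCube q) x.2) :=
    ((hτ.contMDiffOn_cubeMap x.2 hx.2).mdifferentiableWithinAt (by simp)).hasMFDerivWithinAt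
  have hf := HasMFDerivWithinAt.comp x h1 (ContinuousLinearMap.fst ℝ (Fin p → ℝ) (Fin q → ℝ)).hasMFDerivWithinAt
    (fun y (hy : y ∈ (unitCube p ×ˢ unitCube q : Set (X p q))) ↦ hy.1)
  have hg := HasMFDerivWithinAt.comp x h2 (ContinuousLinearMap.snd ℝ (Fin p → ℝ) (Fin q → ℝ)).hasMFDerivWithinAt
    (fun y (hy : y ∈ (unitCube p ×ˢ unitCube q : Set (X p q))) ↦ hy.2)
  exact hf.prodMk hg

/-- **The derivative of the product parametrisation on a vector `(v, v')` is `(Dσ v, Dτ v')`.** [cite: LeeSmoothManifolds2013, p. 481] -/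
theorem mfderivWithin_prodCubeMap_apply {σ : SingularSimplex M p} {τ : SingularSimplex N q} (hσ : σ.IsSmooth I)
    (hτ : τ.IsSmooth I') {x : X p q} (hx : x ∈ (unitCube p ×ˢ unitCube q : Set (X p q))) (v : X p q) :
    mfderivWithin 𝓘(ℝ, X p q) (I.prod I') (prodCubeMap σ τ) (unitCube p ×ˢ unitCube q) x v =
      ((mfderivWithin 𝓘(ℝ, Fin p → ℝ) I σ.cubeMap (unitCube p) x.1 v.1 : E),
        (mfderivWithin 𝓘(ℝ, Fin q → ℝ) I' τ.cubeMap (unitCube q) x.2 v.2 : E')) := by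
  rw [(hasMFDerivWithinAt_prodCubeMap hσ hτ hx).mfderivWithin ((uniqueDiffOn_prodCube p q x hx).uniqueMDiffWithinAt)]
  rfl

/-- The derivative of the product parametrisation maps the block frame to the block family of the
two frames' images. [folklore] -/
theorem mfderivWithin_prodCubeMap_stdBlock {σ : SingularSimplex M p} {τ : SingularSimplex N q} (hσ : σ.IsSmooth I)
    (hτ : τ.IsSmooth I') {x : X p q} (hx : x ∈ (unitCube p ×ˢ unitCube q : Set (X p q))) (h : p + q = n) :
    (fun i ↦ mfderivWithin 𝓘(ℝ, X p q) (I.prod I') (prodCubeMap σ τ) (unitCube p ×ˢ unitCube q) x (stdBlock p q n h i)) =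
      blockVec (E := E) (E' := E') p q n h
        (fun a ↦ (mfderivWithin 𝓘(ℝ, Fin p → ℝ) I σ.cubeMap (unitCube p) x.1 (Pi.single a 1) : E))
        (fun b ↦ (mfderivWithin 𝓘(ℝ, Fin q → ℝ) I' τ.cubeMap (unitCube q) x.2 (Pi.single b 1) : E')) := by
  funext i
  rw [mfderivWithin_prodCubeMap_apply hσ hτ hx]
  by_cases hi : (i : ℕ) < p
  · rw [stdBlock_of_lt h hi, blockVec_of_lt h _ _ hi]
    simp
  · rw [stdBlock_of_le h (not_lt.mp hi), blockVec_of_le h _ _ (not_lt.mp hi)]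
    simp

/-! ### The integrand of a shuffle simplex -/

/-- **The integrand of a shuffle simplex is the shuffle integrand of the within-cube pull-back along
the product parametrisation** (chain rule within the cube). [cite: LeeSmoothManifolds2013, Prop. 18.9] -/
theorem formIntegrand_tupleSimplex {σ : SingularSimplex M p} {τ : SingularSimplex N q} (hσ : σ.IsSmooth I)
    (hτ : τ.IsSmooth I') (hn : p + q = n) {w : Fin (n + 1) → V} (hw : w ∈ (shuffle n p).support)
    (η : MForm (I.prod I') (M × N) F n) {t : Fin n → ℝ} (ht : t ∈ unitCube n) :
    (tupleSimplex σ τ w).formIntegrand η t =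
      shuffleIntegrand p q (η.pullbackWithin (prodCubeMap σ τ) (unitCube p ×ˢ unitCube q)) w t := by
  rw [SingularSimplex.formIntegrand_apply, shuffleIntegrand, MForm.pullbackWithin_apply]
  have hpt : (tupleSimplex σ τ w).cubeMap t = prodCubeMap σ τ (Phi p q w t) := cubeMap_tupleSimplex σ τ hn hw ht
  have hPhi : Phi p q w t ∈ (unitCube p ×ˢ unitCube q : Set (X p q)) := Phi_mem_prod p q w ht
  have hD : ∀ v, mfderivWithin 𝓘(ℝ, Fin n → ℝ) (I.prod I') (tupleSimplex σ τ w).cubeMap (unitCube n) t v =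
      mfderivWithin 𝓘(ℝ, X p q) (I.prod I') (prodCubeMap σ τ) (unitCube p ×ˢ unitCube q) (Phi p q w t)
        (fderiv ℝ (Phi p q w) t v) := by
    intro v
    have heq : mfderivWithin 𝓘(ℝ, Fin n → ℝ) (I.prod I') (tupleSimplex σ τ w).cubeMap (unitCube n) t =
        mfderivWithin 𝓘(ℝ, Fin n → ℝ) (I.prod I') (prodCubeMap σ τ ∘ Phi p q w) (unitCube n) t :=
      Filter.EventuallyEq.mfderivWithin_eq
        (eventually_nhdsWithin_of_forall fun y hy ↦ cubeMap_tupleSimplex σ τ hn hw hy) hpt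
    have huniq : UniqueMDiffWithinAt 𝓘(ℝ, Fin n → ℝ) (unitCube n) t := ((uniqueDiffOn_unitCube n) t ht).uniqueMDiffWithinAt
    have hg : MDifferentiableWithinAt 𝓘(ℝ, X p q) (I.prod I') (prodCubeMap σ τ) (unitCube p ×ˢ unitCube q) (Phi p q w t) :=
      (contMDiffOn_prodCubeMap hσ hτ _ hPhi).mdifferentiableWithinAt (by simp)
    have hf : MDifferentiableWithinAt 𝓘(ℝ, Fin n → ℝ) 𝓘(ℝ, X p q) (Phi p q w) (unitCube n) t :=
      ((contDiff_Phi (m := ∞) p q w).contMDiff.mdifferentiable (by simp) t).mdifferentiableWithinAt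
    rw [heq, mfderivWithin_comp t hg hf (fun y hy ↦ Phi_mem_prod p q w hy) huniq]
    have h3 : mfderivWithin 𝓘(ℝ, Fin n → ℝ) 𝓘(ℝ, X p q) (Phi p q w) (unitCube n) t = fderiv ℝ (Phi p q w) t := by
      rw [mfderivWithin_eq_fderivWithin, fderivWithin_eq_fderiv ((uniqueDiffOn_unitCube n) t ht) ((differentiable_Phi p q w) t)]
    rw [h3]
    rfl
  rw [MForm.congr_point η hpt]
  congr 1
  funext i
  exact hD _

/-! ### The cross product form -/

section Cross

variable (I I')

/-- **The cross product form** `α ⊠ β = pr₁^*α ∧ pr₂^*β` on `M × N`. [cite: Bredon1993, VI §4] -/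
def crossForm (α : MForm I M ℝ k) (β : MForm I' N ℝ l) : MForm (I.prod I') (M × N) ℝ (k + l) :=
  (α.pullback (I.prod I') Prod.fst).wedge (β.pullback (I.prod I') Prod.snd)

variable {I I'}

/-- Pointwise, the cross product form is the wedge of the pre-compositions with the projections. [folklore] -/
theorem crossForm_apply (α : MForm I M ℝ k) (β : MForm I' N ℝ l) (z : M × N) (v : Fin (k + l) → E × E') :
    crossForm I I' α β z v =
      ((α z.1).compContinuousLinearMap (ContinuousLinearMap.fst ℝ E E')).wedge
        ((β z.2).compContinuousLinearMap (ContinuousLinearMap.snd ℝ E E')) v := by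
  simp only [crossForm, MForm.wedge, MForm.pullback, mfderiv_fst, mfderiv_snd]
  rfl

/-- **The cross product of smooth forms is smooth** (the wedge and pull-back calculus of the tree,
both unconditional). [cite: Bredon1993, VI §4] -/
theorem isSmoothForm_crossForm [IsManifold I ∞ M] [IsManifold I' ∞ N] {α : MForm I M ℝ k} {β : MForm I' N ℝ l}
    (hα : IsSmoothForm α) (hβ : IsSmoothForm β) : IsSmoothForm (crossForm I I' α β) := by
  haveI : WedgeFacts (I.prod I') (M × N) ℝ :=
    wedgeFacts_of_assoc (I.prod I') (M × N) ℝ (ContinuousAlternatingMap.WedgeAssoc_holds ℝ (E × E') ℝ)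
  exact isSmoothForm_wedge (isSmoothForm_pullback contMDiff_fst hα) (isSmoothForm_pullback contMDiff_snd hβ)

end Cross

/-! ### The clamp onto the product of cubes -/

/-- The coordinatewise clamp of `ℝᵖ × ℝ^q` onto `[0,1]ᵖ × [0,1]^q`. [folklore] -/
def clampCube (p q : ℕ) (x : X p q) : X p q := (fun i ↦ max 0 (min 1 (x.1 i)), fun j ↦ max 0 (min 1 (x.2 j)))

/-- The clamp is continuous. [folklore] -/
theorem continuous_clampCube (p q : ℕ) : Continuous (clampCube p q) := by
  refine Continuous.prodMk (continuous_pi fun i ↦ ?_) (continuous_pi fun j ↦ ?_)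
  · show Continuous fun x : X p q ↦ max (0 : ℝ) (min 1 (x.1 i))
    exact continuous_const.max (continuous_const.min ((continuous_apply i).comp continuous_fst))
  · show Continuous fun x : X p q ↦ max (0 : ℝ) (min 1 (x.2 j))
    exact continuous_const.max (continuous_const.min ((continuous_apply j).comp continuous_snd))

/-- The clamp takes values in the product of cubes. [folklore] -/
theorem clampCube_mem (p q : ℕ) (x : X p q) : clampCube p q x ∈ (unitCube p ×ˢ unitCube q : Set (X p q)) := by
  refine ⟨⟨fun i ↦ le_max_left _ _, fun i ↦ max_le zero_le_one (min_le_left _ _)⟩,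
    ⟨fun j ↦ le_max_left _ _, fun j ↦ max_le zero_le_one (min_le_left _ _)⟩⟩

/-- The clamp is the identity on the product of cubes. [folklore] -/
theorem clampCube_eq_of_mem (p q : ℕ) {x : X p q} (hx : x ∈ (unitCube p ×ˢ unitCube q : Set (X p q))) : clampCube p q x = x := by
  refine Prod.ext (funext fun i ↦ ?_) (funext fun j ↦ ?_)
  · simp only [clampCube]
    rw [min_eq_right (show x.1 i ≤ 1 from hx.1.2 i), max_eq_right (show 0 ≤ x.1 i from hx.1.1 i)]
  · simp only [clampCube]
    rw [min_eq_right (show x.2 j ≤ 1 from hx.2.2 j), max_eq_right (show 0 ≤ x.2 j from hx.2.1 j)]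

/-! ### The shuffle sum of the integrals of the cross product form -/

section Main

variable [IsManifold I ∞ M] [IsManifold I' ∞ N]

/-- **The signed sum over the shuffles of the integrals of a smooth `(p+q)`-form over the shuffle
simplices of `σ × τ` is the integral of the pulled-back form on the block frame over the product
of cubes.** [cite: Bredon1993, VI §4] -/
theorem shuffle_sum_formIntegral_eq_setIntegral {σ : SingularSimplex M p} {τ : SingularSimplex N q} (hσ : σ.IsSmooth I)
    (hτ : τ.IsSmooth I') (hn : p + q = n) {η : MForm (I.prod I') (M × N) F n} [CompleteSpace F] (hη : IsSmoothForm η) :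
    ((shuffle n p).sum fun w z ↦ (z : ℝ) • (tupleSimplex σ τ w).formIntegral η) =
      ∫ x in (unitCube p ×ˢ unitCube q : Set (X p q)),
        η (prodCubeMap σ τ x) (blockVec (E := E) (E' := E') p q n hn
          (fun a ↦ (mfderivWithin 𝓘(ℝ, Fin p → ℝ) I σ.cubeMap (unitCube p) x.1 (Pi.single a 1) : E))
          (fun b ↦ (mfderivWithin 𝓘(ℝ, Fin q → ℝ) I' τ.cubeMap (unitCube q) x.2 (Pi.single b 1) : E'))) := by
  set Ω : X p q → X p q [⋀^Fin n]→L[ℝ] F := η.pullbackWithin (prodCubeMap σ τ) (unitCube p ×ˢ unitCube q) with hΩ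
  have hΩc : ContinuousOn Ω (unitCube p ×ˢ unitCube q) :=
    MForm.continuousOn_pullbackWithin (uniqueDiffOn_prodCube p q) (contMDiffOn_prodCubeMap hσ hτ)
      fun x _ ↦ (isSmoothForm_iff_smoothAt η).1 hη _
  set Ω' : X p q → X p q [⋀^Fin n]→L[ℝ] F := fun x ↦ Ω (clampCube p q x) with hΩ'
  have hΩ'c : Continuous Ω' := hΩc.comp_continuous (continuous_clampCube p q) (clampCube_mem p q)
  have hmain := shuffle_sum_setIntegral_eq hn Ω' hΩ'c
  -- the left-hand sides agree
  have hL : ((shuffle n p).sum fun w z ↦ (z : ℝ) • (tupleSimplex σ τ w).formIntegral η) =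
      (shuffle n p).sum fun w z ↦ (z : ℝ) • ∫ t in Icc (0 : Fin n → ℝ) 1, shuffleIntegrand p q Ω' w t := by
    refine Finsupp.sum_congr fun w hw ↦ ?_
    congr 1
    refine setIntegral_congr_fun measurableSet_Icc fun t ht ↦ ?_
    rw [formIntegrand_tupleSimplex hσ hτ hn hw η ht, shuffleIntegrand, shuffleIntegrand]
    simp only [hΩ', hΩ, clampCube_eq_of_mem p q (Phi_mem_prod p q w ht)]
  rw [hL, hmain]
  refine setIntegral_congr_fun (measurableSet_Icc.prod measurableSet_Icc) fun x hx ↦ ?_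
  have h1 : Ω' x = Ω x := by simp only [hΩ', clampCube_eq_of_mem p q hx]
  rw [h1]
  exact congrArg (η (prodCubeMap σ τ x)) (mfderivWithin_prodCubeMap_stdBlock hσ hτ hx hn)

/-- **`Σ_w ± ∫_{(σ,τ)_w} α ⊠ β = (∫_σ α)(∫_τ β)`** for smooth simplices and smooth forms of matched
degrees. [cite: Bredon1993, VI §4] -/
theorem shuffle_sum_formIntegral_crossForm {σ : SingularSimplex M k} {τ : SingularSimplex N l} (hσ : σ.IsSmooth I)
    (hτ : τ.IsSmooth I') {α : MForm I M ℝ k} {β : MForm I' N ℝ l} (hα : IsSmoothForm α) (hβ : IsSmoothForm β) :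
    ((shuffle (k + l) k).sum fun w z ↦ (z : ℝ) • (tupleSimplex σ τ w).formIntegral (crossForm I I' α β)) =
      σ.formIntegral α * τ.formIntegral β := by
  rw [shuffle_sum_formIntegral_eq_setIntegral hσ hτ rfl (isSmoothForm_crossForm hα hβ)]
  have h : ∀ x : X k l, crossForm I I' α β (prodCubeMap σ τ x) (blockVec (E := E) (E' := E') k l (k + l) rfl
      (fun a ↦ (mfderivWithin 𝓘(ℝ, Fin k → ℝ) I σ.cubeMap (unitCube k) x.1 (Pi.single a 1) : E))
      (fun b ↦ (mfderivWithin 𝓘(ℝ, Fin l → ℝ) I' τ.cubeMap (unitCube l) x.2 (Pi.single b 1) : E'))) =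
      σ.formIntegrand α x.1 * τ.formIntegrand β x.2 := fun x ↦ by
    rw [crossForm_apply]
    exact wedge_fst_snd_apply_blockVec (𝕜 := ℝ) (E := E) (E' := E') (α (σ.cubeMap x.1) : E [⋀^Fin k]→L[ℝ] ℝ)
      (β (τ.cubeMap x.2) : E' [⋀^Fin l]→L[ℝ] ℝ) _ _
  simp_rw [h]
  rw [Measure.volume_eq_prod, setIntegral_prod_mul]
  rfl

/-- **Mismatched degrees**: over the shuffle product of a `p`-simplex and a `q`-simplex with
`p + q = k + l`, `p ≠ k`, the cross product `α ⊠ β` of a `k`-form and an `l`-form integrates to `0`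
(shuffle by shuffle the integrand vanishes). [cite: Bredon1993, VI §4] -/
theorem shuffle_sum_formIntegral_crossForm_eq_zero {σ : SingularSimplex M p} {τ : SingularSimplex N q} (hσ : σ.IsSmooth I)
    (hτ : τ.IsSmooth I') (h : p + q = k + l) (hp : p ≠ k) {α : MForm I M ℝ k} {β : MForm I' N ℝ l}
    (hα : IsSmoothForm α) (hβ : IsSmoothForm β) :
    ((shuffle (k + l) p).sum fun w z ↦ (z : ℝ) • (tupleSimplex σ τ w).formIntegral (crossForm I I' α β)) = 0 := by
  rw [shuffle_sum_formIntegral_eq_setIntegral hσ hτ h (isSmoothForm_crossForm hα hβ)]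
  refine setIntegral_eq_zero_of_forall_eq_zero fun x _ ↦ ?_
  rw [crossForm_apply]
  exact wedge_fst_snd_apply_blockVec_eq_zero (𝕜 := ℝ) (E := E) (E' := E') h hp (α (σ.cubeMap x.1) : E [⋀^Fin k]→L[ℝ] ℝ)
    (β (τ.cubeMap x.2) : E' [⋀^Fin l]→L[ℝ] ℝ) _ _

omit [IsManifold I ∞ M] [IsManifold I' ∞ N] in
/-- The integration functional on a shuffle product is the signed shuffle sum of the integrals. [folklore] -/
theorem integrationFunctional_ezMap (σ : SingularSimplex M p) (τ : SingularSimplex N q) (η : MForm (I.prod I') (M × N) ℝ n) :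
    integrationFunctional η (ezMap ℝ ℝ n σ τ 1) =
      (shuffle n p).sum fun w z ↦ (z : ℝ) • (tupleSimplex σ τ w).formIntegral η := by
  rw [ezMap, realize₂_eq_sum, map_finsuppSum]
  refine Finsupp.sum_congr fun w _ ↦ ?_
  rw [map_zsmul, integrationFunctional_single, one_mul, ← Int.cast_smul_eq_zsmul ℝ]

omit [IsManifold I ∞ M] [IsManifold I' ∞ N] in
/-- **`∫_{σ × τ} α ⊠ β = (∫_σ α)(∫_τ β)`**: the integral of the cross product of smooth forms over the
Eilenberg–Zilber shuffle product of smooth simplices of matched degrees. [cite: Bredon1993, VI §4] -/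
theorem integrationFunctional_crossForm_ezMap [IsManifold I ∞ M] [IsManifold I' ∞ N] {σ : SingularSimplex M k}
    {τ : SingularSimplex N l} (hσ : σ.IsSmooth I) (hτ : τ.IsSmooth I') {α : MForm I M ℝ k} {β : MForm I' N ℝ l}
    (hα : IsSmoothForm α) (hβ : IsSmoothForm β) :
    integrationFunctional (crossForm I I' α β) (ezMap ℝ ℝ (k + l) σ τ 1) = σ.formIntegral α * τ.formIntegral β := by
  rw [integrationFunctional_ezMap, shuffle_sum_formIntegral_crossForm hσ hτ hα hβ]

omit [IsManifold I ∞ M] [IsManifold I' ∞ N] in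
/-- **`∫_{σ × τ} α ⊠ β = 0`** over the shuffle product of smooth simplices of mismatched degrees
`(p, q)`, `p + q = k + l`, `p ≠ k`. [cite: Bredon1993, VI §4] -/
theorem integrationFunctional_crossForm_ezMap_eq_zero [IsManifold I ∞ M] [IsManifold I' ∞ N] {σ : SingularSimplex M p}
    {τ : SingularSimplex N q} (hσ : σ.IsSmooth I) (hτ : τ.IsSmooth I') (h : p + q = k + l) (hp : p ≠ k)
    {α : MForm I M ℝ k} {β : MForm I' N ℝ l} (hα : IsSmoothForm α) (hβ : IsSmoothForm β) :
    integrationFunctional (crossForm I I' α β) (ezMap ℝ ℝ (k + l) σ τ 1) = 0 := by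
  rw [integrationFunctional_ezMap, shuffle_sum_formIntegral_crossForm_eq_zero hσ hτ h hp hα hβ]

end Main

end Literature.Geometry.Manifold
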